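import Mathlib
import HarnessLib
import Literature.Analysis.Complex.VerticalSinSummation
import Literature.NumberTheory.LFunctions.HorocycleRHMellinShift
import Literature.NumberTheory.LFunctions.ZetaSqReflectionPrinciple

/-!
# The unit halfStrip step for `(π / sin πt)²`-line integrals across a double zero

HONEST FRAMING: systematic search; no irrationality claim unless certified.  This file is pure complex analysis (no forms,
no measure): the ONE analytic move behind `StripShift` in `Denom/TwoTaleP15Decay` (and its rung-A analogue), isolated and
PROVED in abstract form.  If `g` is holomorphic on the closed halfStrip `m − ½ ≤ Re t ≤ m + ½` around an integer `m`, has a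
DOUBLE ZERO at `m` (`g(m) = 0`, `g'(m) = 0`) and polynomial growth `‖g(t)‖ ≤ A (1 + (Im t)²)^N` there, then
`∫ (π/sin π(m−½+iy))² g(m−½+iy) dy = ∫ (π/sin π(m+½+iy))² g(m+½+iy) dy` (`integral_kernel_step`).
The double pole of `(π/sin πt)²` at `m` is cancelled WITHOUT a removable-singularity argument: with the desingularised sine
`dsin m = dslope (sin π·) m` (`= sin πt/(t−m)` off `m`, `= π cos πm ≠ 0` at `m`) and `Q = dslope (dslope g m) m`
(`(t−m)² Q = g`), the function `F = π²/dsin² · Q` is holomorphic on the halfStrip, equals `(π/sin πt)² g(t)` off `m`, and is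
`O(1/(1+y²))` uniformly (compactness for `|y| ≤ 1`, `sinh² πy ≳ (1+y²)^{N+1}` beyond, via the tree's `ZetaM4.exp_le_four_mul_sinh`); the tree's
`integral_vertical_eq_of_norm_le_div` (Cauchy on rectangles, `T → ∞`) then shifts the line.  For Zudilin's first-tale
integrand `(π/sin πt)² R(t − a₂*)` the hypothesis holds at every integer `1 ≤ m ≤ 9n` (P15) resp. `1 ≤ m ≤ 4n` (rung A),
where two numerator blocks of `R` vanish; iterating the step gives `StripShift` (successor task E4 of families/denom/P15KERNEL.md §7).
-/

noncomputable section

open Complex Set MeasureTheory Filter Topology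

namespace Summit.KontsevichZagierPeriods.Zeta5Search.Denom.KernelStripStep

/-! ### The halfStrip and the desingularised sine -/

/-- The closed unit halfStrip `m − ½ ≤ Re t ≤ m + ½` around the integer `m`. -/
def halfStrip (m : ℤ) : Set ℂ := re ⁻¹' Icc ((m : ℝ) - 1 / 2) ((m : ℝ) + 1 / 2)

/-- The halfStrip is a neighbourhood of `m`. -/
theorem halfStrip_mem_nhds (m : ℤ) : halfStrip m ∈ 𝓝 ((m : ℤ) : ℂ) := by
  have ho : IsOpen (re ⁻¹' Ioo ((m : ℝ) - 1 / 2) ((m : ℝ) + 1 / 2)) := isOpen_Ioo.preimage continuous_re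
  refine mem_of_superset (ho.mem_nhds ?_) (preimage_mono Ioo_subset_Icc_self)
  simp only [mem_preimage, intCast_re, mem_Ioo]
  constructor <;> linarith

/-- The only integer in the halfStrip is `m`. -/
theorem int_mem_halfStrip {m k : ℤ} (hk : ((k : ℤ) : ℂ) ∈ halfStrip m) : k = m := by
  simp only [halfStrip, mem_preimage, intCast_re, mem_Icc] at hk
  have h1 : (k : ℝ) - m ≤ 1 / 2 := by linarith [hk.2]
  have h2 : (m : ℝ) - k ≤ 1 / 2 := by linarith [hk.1]
  have h3 : |((k - m : ℤ) : ℝ)| ≤ 1 / 2 := by push_cast; rw [abs_le]; constructor <;> linarith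
  have h4 : k - m = 0 := by
    by_contra h
    have : (1 : ℝ) ≤ |((k - m : ℤ) : ℝ)| := by exact_mod_cast Int.one_le_abs h
    linarith
  omega

/-- `sin πt ≠ 0` on the halfStrip away from `m`. -/
theorem sin_ne_zero_of_mem_halfStrip {m : ℤ} {t : ℂ} (ht : t ∈ halfStrip m) (htm : t ≠ m) :
    Complex.sin (Real.pi * t) ≠ 0 := by
  intro h
  obtain ⟨k, hk⟩ := Complex.sin_eq_zero_iff.1 h
  have hπ : (Real.pi : ℂ) ≠ 0 := by exact_mod_cast Real.pi_ne_zero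
  have htk : t = k := by
    have : (Real.pi : ℂ) * t = Real.pi * k := by rw [hk, mul_comm]
    exact mul_left_cancel₀ hπ this
  subst htk
  exact htm (by rw [int_mem_halfStrip ht])

/-- **The desingularised sine** `dsin m t = sin πt/(t − m)` (`t ≠ m`), `= π cos πm` at `t = m`. -/
def dsin (m : ℤ) : ℂ → ℂ := dslope (fun t : ℂ => Complex.sin (Real.pi * t)) m

/-- Off `m`: `dsin m t = sin πt / (t − m)`. -/
theorem dsin_of_ne {m : ℤ} {t : ℂ} (h : t ≠ m) : dsin m t = Complex.sin (Real.pi * t) / (t - m) := by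
  rw [dsin, dslope_of_ne _ h, slope_def_field]
  have : Complex.sin (Real.pi * (m : ℂ)) = 0 := by rw [mul_comm]; exact_mod_cast Complex.sin_int_mul_pi m
  rw [this, sub_zero]

/-- At `m`: `dsin m m = π cos πm`. -/
theorem dsin_same (m : ℤ) : dsin m m = Real.pi * Complex.cos (Real.pi * m) := by
  rw [dsin, dslope_same]
  have h : HasDerivAt (fun t : ℂ => Complex.sin (Real.pi * t)) (Complex.cos (Real.pi * m) * (Real.pi * 1)) (m : ℂ) :=
    (Complex.hasDerivAt_sin _).comp _ ((hasDerivAt_id (m : ℂ)).const_mul _)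
  rw [h.deriv]; ring

/-- `dsin m` is entire (`Complex.differentiableOn_dslope`). -/
theorem differentiable_dsin (m : ℤ) : Differentiable ℂ (dsin m) := by
  have h : DifferentiableOn ℂ (dsin m) univ :=
    (Complex.differentiableOn_dslope univ_mem).2 (by fun_prop)
  exact differentiableOn_univ.1 h

/-- `dsin m ≠ 0` on the halfStrip. -/
theorem dsin_ne_zero {m : ℤ} {t : ℂ} (ht : t ∈ halfStrip m) : dsin m t ≠ 0 := by
  by_cases h : t = m
  · subst h
    rw [dsin_same]
    have hs : Complex.sin (Real.pi * (m : ℂ)) = 0 := by rw [mul_comm]; exact_mod_cast Complex.sin_int_mul_pi m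
    have hc : Complex.cos (Real.pi * (m : ℂ)) ≠ 0 := by
      intro hc
      have := Complex.cos_sq_add_sin_sq (Real.pi * (m : ℂ))
      rw [hc, hs] at this; norm_num at this
    exact mul_ne_zero (by exact_mod_cast Real.pi_ne_zero) hc
  · rw [dsin_of_ne h]
    exact div_ne_zero (sin_ne_zero_of_mem_halfStrip ht h) (sub_ne_zero.2 h)

/-! ### A polynomial is eventually dominated by `sinh²` -/

/-- For `|y| ≥ 1`: `(1 + y²)^{N+1} ≤ K · sinh²(πy)` with an explicit `K`. -/
theorem pow_le_sinh_sq (N : ℕ) {y : ℝ} (hy : 1 ≤ |y|) :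
    (1 + y ^ 2) ^ (N + 1) ≤
      (2 : ℝ) ^ (N + 1) / Real.pi ^ (2 * N + 2) * (Nat.factorial (2 * N + 2)) * 4 * Real.sinh (Real.pi * y) ^ 2 := by
  set u : ℝ := Real.pi * |y| with hu
  have hπ : 3 < Real.pi := Real.pi_gt_three
  have hu1 : 1 ≤ u := by rw [hu]; nlinarith
  have hu0 : 0 ≤ u := by linarith
  -- (1 + y²)^{N+1} ≤ 2^{N+1} |y|^{2N+2} = 2^{N+1} u^{2N+2} / π^{2N+2}
  have hy2 : y ^ 2 = |y| ^ 2 := (sq_abs y).symm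
  have h1 : (1 + y ^ 2) ^ (N + 1) ≤ (2 * |y| ^ 2) ^ (N + 1) :=
    pow_le_pow_left₀ (by positivity) (by rw [hy2]; nlinarith) _
  have h1' : (2 * |y| ^ 2) ^ (N + 1) = 2 ^ (N + 1) * (u ^ (2 * N + 2) / Real.pi ^ (2 * N + 2)) := by
    rw [hu]
    field_simp
    ring
  -- u^{2N+2} ≤ (2N+2)! e^u ≤ (2N+2)! · 4 sinh u ≤ (2N+2)! · 4 sinh² u
  have h3 : u ^ (2 * N + 2) ≤ (Nat.factorial (2 * N + 2)) * Real.exp u := by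
    have h := Real.pow_div_factorial_le_exp u hu0 (2 * N + 2)
    rw [div_le_iff₀ (by positivity)] at h
    linarith
  have h4 : Real.exp u ≤ 4 * Real.sinh u := Literature.NumberTheory.LFunctions.ZetaM4.exp_le_four_mul_sinh hu1
  have h5 : Real.sinh u ≤ Real.sinh u ^ 2 := by
    have : 1 ≤ Real.sinh u := hu1.trans (Real.self_le_sinh_iff.2 hu0)
    nlinarith
  have h6 : Real.sinh u ^ 2 = Real.sinh (Real.pi * y) ^ 2 := by
    have e1 : Real.sinh u ^ 2 = Real.cosh u ^ 2 - 1 := by rw [Real.cosh_sq]; ring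
    have e2 : Real.sinh (Real.pi * y) ^ 2 = Real.cosh (Real.pi * y) ^ 2 - 1 := by rw [Real.cosh_sq]; ring
    rw [e1, e2, hu]
    rcases le_or_gt 0 y with h | h
    · rw [abs_of_nonneg h]
    · rw [abs_of_neg h, mul_neg, Real.cosh_neg]
  have hfac : (0 : ℝ) < Nat.factorial (2 * N + 2) := by positivity
  calc (1 + y ^ 2) ^ (N + 1) ≤ 2 ^ (N + 1) * (u ^ (2 * N + 2) / Real.pi ^ (2 * N + 2)) := h1.trans_eq h1'
    _ ≤ 2 ^ (N + 1) * (((Nat.factorial (2 * N + 2)) * (4 * Real.sinh u ^ 2)) / Real.pi ^ (2 * N + 2)) := by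
        gcongr
        calc u ^ (2 * N + 2) ≤ (Nat.factorial (2 * N + 2)) * Real.exp u := h3
          _ ≤ (Nat.factorial (2 * N + 2)) * (4 * Real.sinh u ^ 2) := by gcongr; linarith
    _ = _ := by rw [h6]; ring

/-! ### The step -/

/-- `‖(π / sin πt)²‖ ≤ π² / sinh²(π Im t)` (when `Im t ≠ 0`). -/
theorem norm_piDivSin_sq_le {t : ℂ} (ht : t.im ≠ 0) :
    ‖((Real.pi : ℂ) / Complex.sin (Real.pi * t)) ^ 2‖ ≤ Real.pi ^ 2 / Real.sinh (Real.pi * t.im) ^ 2 := by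
  have hsh : 0 < Real.sinh (Real.pi * t.im) ^ 2 := by
    have : Real.sinh (Real.pi * t.im) ≠ 0 := by
      rw [Real.sinh_eq_zero.ne]; exact mul_ne_zero Real.pi_ne_zero ht
    positivity
  have hsin : Real.sinh (Real.pi * t.im) ^ 2 ≤ ‖Complex.sin (Real.pi * t)‖ ^ 2 := by
    rw [Literature.Analysis.Complex.norm_sin_sq_eq]
    have : ((Real.pi : ℂ) * t).im = Real.pi * t.im := by simp
    rw [this]; nlinarith [sq_nonneg (Real.sin ((Real.pi : ℂ) * t).re)]
  rw [norm_pow, norm_div, Complex.norm_real, Real.norm_eq_abs, abs_of_pos Real.pi_pos, div_pow]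
  exact div_le_div_of_nonneg_left (by positivity) hsh hsin

/-- **The unit halfStrip step across a double zero.**  `g` holomorphic on the closed halfStrip `|Re t − m| ≤ ½`, `g(m) = g'(m) = 0`,
`‖g(t)‖ ≤ A (1 + (Im t)²)^N` on the halfStrip ⟹ the `(π/sin πt)²`-weighted line integrals over `Re t = m ∓ ½` agree. -/
theorem integral_kernel_step {g : ℂ → ℂ} {m : ℤ} {A : ℝ} {N : ℕ}
    (hg : DifferentiableOn ℂ g (halfStrip m)) (h0 : g m = 0) (h1 : deriv g m = 0)
    (hA : ∀ t ∈ halfStrip m, ‖g t‖ ≤ A * (1 + t.im ^ 2) ^ N) :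
    ∫ y : ℝ, ((Real.pi : ℂ) / Complex.sin (Real.pi * ((((m : ℝ) - 1 / 2 : ℝ) : ℂ) + (y : ℂ) * I))) ^ 2 *
        g ((((m : ℝ) - 1 / 2 : ℝ) : ℂ) + (y : ℂ) * I) =
      ∫ y : ℝ, ((Real.pi : ℂ) / Complex.sin (Real.pi * ((((m : ℝ) + 1 / 2 : ℝ) : ℂ) + (y : ℂ) * I))) ^ 2 *
        g ((((m : ℝ) + 1 / 2 : ℝ) : ℂ) + (y : ℂ) * I) := by
  -- the desingularised integrand
  set Q : ℂ → ℂ := dslope (dslope g m) m with hQdef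
  have hQ : DifferentiableOn ℂ Q (halfStrip m) :=
    (Complex.differentiableOn_dslope (halfStrip_mem_nhds m)).2
      ((Complex.differentiableOn_dslope (halfStrip_mem_nhds m)).2 hg)
  have hQg : ∀ t, (t - m) ^ 2 * Q t = g t := by
    intro t
    have e1 : (t - m) * dslope g m t = g t := by
      have := sub_smul_dslope g (m : ℂ) t; rwa [smul_eq_mul, h0, sub_zero] at this
    have e2 : (t - m) * Q t = dslope g m t := by
      have := sub_smul_dslope (dslope g m) (m : ℂ) t; rwa [smul_eq_mul, dslope_same, h1, sub_zero] at this
    rw [sq, mul_assoc, e2, e1]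
  set F : ℂ → ℂ := fun t => (Real.pi : ℂ) ^ 2 / dsin m t ^ 2 * Q t with hFdef
  have hF : DifferentiableOn ℂ F (halfStrip m) := by
    refine DifferentiableOn.mul (DifferentiableOn.div (differentiableOn_const _)
      ((differentiable_dsin m).differentiableOn.pow 2) fun t ht => pow_ne_zero 2 (dsin_ne_zero ht)) hQ
  have hFeq : ∀ t ∈ halfStrip m, t ≠ m →
      F t = ((Real.pi : ℂ) / Complex.sin (Real.pi * t)) ^ 2 * g t := by
    intro t ht htm
    have hs := sin_ne_zero_of_mem_halfStrip ht htm
    have htm' : t - m ≠ 0 := sub_ne_zero.2 htm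
    simp only [hFdef]
    rw [dsin_of_ne htm, ← hQg t]
    field_simp
  -- points of the halfStrip
  have hmem : ∀ x y : ℝ, x ∈ Icc ((m : ℝ) - 1 / 2) ((m : ℝ) + 1 / 2) → ((x : ℂ) + (y : ℂ) * I) ∈ halfStrip m := by
    intro x y hx; simpa [halfStrip] using hx
  -- (i) compact part `|y| ≤ 1`
  set K : Set ℂ := halfStrip m ∩ im ⁻¹' Icc (-1) 1 with hKdef
  have hKc : IsCompact K := by
    refine Metric.isCompact_of_isClosed_isBounded ?_ ?_
    · exact (isClosed_Icc.preimage continuous_re).inter (isClosed_Icc.preimage continuous_im)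
    · rw [isBounded_iff_forall_norm_le]
      refine ⟨|(m : ℝ)| + 1 / 2 + 1, fun t ht => ?_⟩
      simp only [hKdef, halfStrip, mem_inter_iff, mem_preimage, mem_Icc] at ht
      have h1 : |t.re| ≤ |(m : ℝ)| + 1 / 2 := by
        rw [abs_le]; constructor <;> cases abs_cases (m : ℝ) <;> linarith [ht.1.1, ht.1.2]
      have h2 : |t.im| ≤ 1 := abs_le.2 ⟨ht.2.1, ht.2.2⟩
      linarith [norm_le_abs_re_add_abs_im t]
  obtain ⟨B, hB⟩ := hKc.exists_bound_of_continuousOn (hF.continuousOn.mono inter_subset_left)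
  -- (ii) the tail `|y| ≥ 1`
  have hA0 : 0 ≤ A := by
    have h := hA (m : ℂ) (mem_of_mem_nhds (halfStrip_mem_nhds m))
    simp only [intCast_im] at h
    have : (0 : ℝ) ≤ A * (1 + 0 ^ 2) ^ N := (norm_nonneg _).trans h
    simpa using this
  set Kt : ℝ := (2 : ℝ) ^ (N + 1) / Real.pi ^ (2 * N + 2) * (Nat.factorial (2 * N + 2)) * 4 with hKt
  have hKt0 : 0 ≤ Kt := by positivity
  set C : ℝ := max (2 * B) (Real.pi ^ 2 * A * Kt) with hC
  have hbound : ∀ x y : ℝ, x ∈ Icc ((m : ℝ) - 1 / 2) ((m : ℝ) + 1 / 2) →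
      ‖F ((x : ℂ) + (y : ℂ) * I)‖ ≤ C / (1 + y ^ 2) := by
    intro x y hx
    have ht := hmem x y hx
    have hy0 : (0 : ℝ) < 1 + y ^ 2 := by positivity
    rw [le_div_iff₀ hy0]
    rcases le_or_gt |y| 1 with hy | hy
    · -- compact part
      have hK : ((x : ℂ) + (y : ℂ) * I) ∈ K := ⟨ht, by simpa [hKdef, abs_le] using hy⟩
      have h := hB _ hK
      have hy2 : y ^ 2 ≤ 1 := by rw [← sq_abs]; nlinarith [abs_nonneg y]
      calc ‖F ((x : ℂ) + (y : ℂ) * I)‖ * (1 + y ^ 2) ≤ B * 2 := by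
            refine mul_le_mul h (by linarith) hy0.le ((norm_nonneg _).trans h)
        _ ≤ C := by rw [hC, mul_comm]; exact le_max_left _ _
    · -- tail: `F = (π/sin)² g` there
      have hyne : y ≠ 0 := by intro h; rw [h, abs_zero] at hy; linarith
      have htm : ((x : ℂ) + (y : ℂ) * I) ≠ m := by
        intro h; have := congrArg im h; simp at this; exact hyne this
      rw [hFeq _ ht htm, norm_mul]
      have him : ((x : ℂ) + (y : ℂ) * I).im = y := by simp
      have hk := norm_piDivSin_sq_le (t := (x : ℂ) + (y : ℂ) * I) (by rw [him]; exact hyne)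
      rw [him] at hk
      have hg' := hA _ ht
      rw [him] at hg'
      have hsh : 0 < Real.sinh (Real.pi * y) ^ 2 := by
        have : Real.sinh (Real.pi * y) ≠ 0 := by rw [Real.sinh_eq_zero.ne]; exact mul_ne_zero Real.pi_ne_zero hyne
        positivity
      have hpoly := pow_le_sinh_sq N hy.le
      rw [← hKt] at hpoly
      calc ‖((Real.pi : ℂ) / Complex.sin (Real.pi * ((x : ℂ) + (y : ℂ) * I))) ^ 2‖ *
            ‖g ((x : ℂ) + (y : ℂ) * I)‖ * (1 + y ^ 2)
          ≤ Real.pi ^ 2 / Real.sinh (Real.pi * y) ^ 2 * (A * (1 + y ^ 2) ^ N) * (1 + y ^ 2) := by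
            gcongr
        _ = Real.pi ^ 2 * A * ((1 + y ^ 2) ^ (N + 1) / Real.sinh (Real.pi * y) ^ 2) := by rw [pow_succ]; ring
        _ ≤ Real.pi ^ 2 * A * Kt := by
            gcongr
            rw [div_le_iff₀ hsh]; exact hpoly
        _ ≤ C := le_max_right _ _
  -- (iii) shift the line
  have hshift := Literature.NumberTheory.LFunctions.integral_vertical_eq_of_norm_le_div
    (σ₁ := (m : ℝ) - 1 / 2) (σ₂ := (m : ℝ) + 1 / 2) (by linarith) hF hbound
  have hl : ((m : ℝ) - 1 / 2) ∈ Icc ((m : ℝ) - 1 / 2) ((m : ℝ) + 1 / 2) := ⟨le_rfl, by linarith⟩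
  have hr : ((m : ℝ) + 1 / 2) ∈ Icc ((m : ℝ) - 1 / 2) ((m : ℝ) + 1 / 2) := ⟨by linarith, le_rfl⟩
  have hne : ∀ (s y : ℝ), s ≠ m → ((s : ℂ) + (y : ℂ) * I) ≠ (m : ℂ) := by
    intro s y hs h; have := congrArg re h; simp at this; exact hs this
  rw [← integral_congr_ae (Filter.Eventually.of_forall fun y =>
      hFeq _ (hmem _ y hl) (hne _ y (by linarith))),
    ← integral_congr_ae (Filter.Eventually.of_forall fun y =>
      hFeq _ (hmem _ y hr) (hne _ y (by linarith)))]
  exact hshift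

/-- **The step with a real base point**: `x = m − ½` for an integer `m`; the lines `Re t = x` and `Re t = x + 1`. -/
theorem integral_kernel_step_real {g : ℂ → ℂ} {m : ℤ} {x A : ℝ} {N : ℕ} (hx : x = (m : ℝ) - 1 / 2)
    (hg : DifferentiableOn ℂ g (halfStrip m)) (h0 : g m = 0) (h1 : deriv g m = 0)
    (hA : ∀ t ∈ halfStrip m, ‖g t‖ ≤ A * (1 + t.im ^ 2) ^ N) :
    ∫ y : ℝ, ((Real.pi : ℂ) / Complex.sin (Real.pi * ((x : ℂ) + (y : ℂ) * I))) ^ 2 * g ((x : ℂ) + (y : ℂ) * I) =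
      ∫ y : ℝ, ((Real.pi : ℂ) / Complex.sin (Real.pi * (((x + 1 : ℝ) : ℂ) + (y : ℂ) * I))) ^ 2 *
        g (((x + 1 : ℝ) : ℂ) + (y : ℂ) * I) := by
  subst hx
  have e2 : (m : ℝ) - 1 / 2 + 1 = (m : ℝ) + 1 / 2 := by ring
  rw [e2]
  exact integral_kernel_step hg h0 h1 hA

end Summit.KontsevichZagierPeriods.Zeta5Search.Denom.KernelStripStep

end
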